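import Mathlib

/-!
# PercRepro — THE BINOMIAL TAIL BY THE CHERNOFF TRICK IN `ℕ`: `16·Σ_{j ≤ K} C(n, j) ≤ 2^n` FOR `8n ≥ 17K + 216` (p9, S4)

`proofs/SUBCLAIM-S4-p9.md` §S4.2⁗‴. The chain's `(Y)`-tail `16·Σ_{j ≤ K} C(n, j) ≤ 2^n` was proved for `n ≥ 3K + 5`
(`sixteen_mul_sum_range_choose_le`, THEOREM P (A4): a ratio induction); it caps every row at `p ≥ 2d + 3q + 5`. The Chernoff
trick needs no induction: for `a ≥ b ≥ 1` every tail term satisfies `a^{n−K}·b^K·C(n, j) ≤ b^j·a^{n−j}·C(n, j)` (`j ≤ K`), so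
`a^{n−K}·b^K·Σ_{j ≤ K} C(n, j) ≤ Σ_j b^j·a^{n−j}·C(n, j) = (a + b)^n` (`choose_tail_mul_le_add_pow`). At `a = 5`, `b = 4`:
`16·Σ_{j ≤ K} C(n, j) ≤ 2^n` follows from `16·9^n ≤ 8^K·10^{n−K}` (`sixteen_mul_nine_pow_le`: `(10/9)^{n−K} ≥ 16·(9/8)^K`
for `n − K ≥ (9/8)K + 27`, by `8^8·10^9 ≥ 9^17` and `10^27 ≥ 16·9^27`) — so the tail holds for `8n ≥ 17K + 216`, i.e.
`n ≥ 2.125·K + 27` in place of `3K + 5` (`sixteen_mul_sum_range_choose_le_chernoff`). Mathlib only. Axioms: standard.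
-/

namespace PercRepro

namespace ThmN

namespace Explicit

/-- **THE CHERNOFF TRICK IN `ℕ`**: for `a ≥ b ≥ 1` and `K ≤ n`, `a^{n−K}·b^K·Σ_{j ≤ K} C(n, j) ≤ (a + b)^n`
(every tail term is dominated by its term of the binomial theorem `(b + a)^n = Σ_j b^j·a^{n−j}·C(n, j)`). -/
theorem choose_tail_mul_le_add_pow (a b n K : ℕ) (hab : b ≤ a) (hK : K ≤ n) :
    a ^ (n - K) * b ^ K * ∑ j ∈ Finset.range (K + 1), n.choose j ≤ (a + b) ^ n := by
  rw [add_comm a b, add_pow, Finset.mul_sum]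
  have hsub : Finset.range (K + 1) ⊆ Finset.range (n + 1) := Finset.range_mono (by omega)
  calc ∑ j ∈ Finset.range (K + 1), a ^ (n - K) * b ^ K * n.choose j
      ≤ ∑ j ∈ Finset.range (K + 1), b ^ j * a ^ (n - j) * n.choose j := by
        apply Finset.sum_le_sum
        intro j hj
        rw [Finset.mem_range] at hj
        apply Nat.mul_le_mul_right
        have e1 : a ^ (n - j) = a ^ (n - K) * a ^ (K - j) := by
          rw [← pow_add]; congr 1; omega
        have e2 : b ^ K = b ^ j * b ^ (K - j) := by
          rw [← pow_add]; congr 1; omega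
        rw [e1, e2]
        calc a ^ (n - K) * (b ^ j * b ^ (K - j)) = b ^ j * a ^ (n - K) * b ^ (K - j) := by ring
          _ ≤ b ^ j * a ^ (n - K) * a ^ (K - j) :=
              Nat.mul_le_mul_left _ (Nat.pow_le_pow_left hab (K - j))
          _ = b ^ j * (a ^ (n - K) * a ^ (K - j)) := by ring
    _ ≤ ∑ j ∈ Finset.range (n + 1), b ^ j * a ^ (n - j) * n.choose j :=
        Finset.sum_le_sum_of_subset_of_nonneg hsub (fun _ _ _ => Nat.zero_le _)

/-- `9^{K+M} ≤ 8^K·10^M` when `9K ≤ 8M`: by eighth powers, `8^{8K}·10^{8M} ≥ (8^8·10^9)^K·9^{8M−9K} ≥ 9^{17K}·9^{8M−9K}`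
(`8^8·10^9 = 16 777 216 000 000 000 ≥ 9^17 = 16 677 181 699 666 569`). -/
theorem nine_pow_le_eight_pow_mul_ten_pow (K M : ℕ) (h : 9 * K ≤ 8 * M) : 9 ^ (K + M) ≤ 8 ^ K * 10 ^ M := by
  have h8 : (9 ^ (K + M)) ^ 8 ≤ (8 ^ K * 10 ^ M) ^ 8 := by
    obtain ⟨r, hr⟩ := Nat.exists_eq_add_of_le h
    have e1 : (9 ^ (K + M)) ^ 8 = 9 ^ (17 * K + r) := by
      rw [← pow_mul]; congr 1; omega
    have e2 : (8 ^ K * 10 ^ M) ^ 8 = (8 ^ 8 * 10 ^ 9) ^ K * 10 ^ r := by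
      have e3 : 10 ^ (M * 8) = 10 ^ (9 * K) * 10 ^ r := by rw [← pow_add]; congr 1; omega
      rw [mul_pow, ← pow_mul, ← pow_mul, e3, mul_pow, ← pow_mul, ← pow_mul]
      ring_nf
    rw [e1, e2, pow_add, pow_mul]
    have h17 : 9 ^ 17 ≤ 8 ^ 8 * 10 ^ 9 := by norm_num
    have h9r : 9 ^ r ≤ 10 ^ r := Nat.pow_le_pow_left (by norm_num) r
    exact Nat.mul_le_mul (Nat.pow_le_pow_left h17 K) h9r
  exact (Nat.pow_le_pow_iff_left (by norm_num : (8 : ℕ) ≠ 0)).1 h8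

/-- **THE EXPONENTIAL STEP**: `16·9^{K+M} ≤ 8^K·10^M` when `9K + 216 ≤ 8M` (`M ≥ (9/8)K + 27`): `10^27 ≥ 16·9^27` and
`nine_pow_le_eight_pow_mul_ten_pow` at `M − 27`. -/
theorem sixteen_mul_nine_pow_le (K M : ℕ) (h : 9 * K + 216 ≤ 8 * M) : 16 * 9 ^ (K + M) ≤ 8 ^ K * 10 ^ M := by
  obtain ⟨M', rfl⟩ : ∃ M', M = M' + 27 := ⟨M - 27, by omega⟩
  have h1 := nine_pow_le_eight_pow_mul_ten_pow K M' (by omega)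
  have h2 : 16 * 9 ^ 27 ≤ 10 ^ 27 := by norm_num
  calc 16 * 9 ^ (K + (M' + 27)) = (16 * 9 ^ 27) * 9 ^ (K + M') := by
        rw [show K + (M' + 27) = (K + M') + 27 by omega, pow_add]; ring
    _ ≤ 10 ^ 27 * (8 ^ K * 10 ^ M') := Nat.mul_le_mul h2 h1
    _ = 8 ^ K * 10 ^ (M' + 27) := by rw [pow_add]; ring

/-- **THE BINOMIAL TAIL FOR `n ≥ (17/8)K + 27`**: `16·Σ_{j ≤ K} C(n, j) ≤ 2^n` when `17K + 216 ≤ 8n` — the Chernoff trick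
at `a = 5`, `b = 4` (`5^{n−K}·4^K·Σ ≤ 9^n`) and the exponential step (`16·9^n ≤ 8^K·10^{n−K} = 2^n·5^{n−K}·4^K`). -/
theorem sixteen_mul_sum_range_choose_le_chernoff (K n : ℕ) (h : 17 * K + 216 ≤ 8 * n) :
    16 * ∑ j ∈ Finset.range (K + 1), n.choose j ≤ 2 ^ n := by
  have hK : K ≤ n := by omega
  obtain ⟨M, rfl⟩ := Nat.exists_eq_add_of_le hK
  have hC := choose_tail_mul_le_add_pow 5 4 (K + M) K (by norm_num) (by omega)
  rw [show K + M - K = M by omega] at hC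
  have hE := sixteen_mul_nine_pow_le K M (by omega)
  have hpos : 0 < 5 ^ M * 4 ^ K := by positivity
  apply Nat.le_of_mul_le_mul_right _ hpos
  calc 16 * (∑ j ∈ Finset.range (K + 1), (K + M).choose j) * (5 ^ M * 4 ^ K)
      = 16 * (5 ^ M * 4 ^ K * ∑ j ∈ Finset.range (K + 1), (K + M).choose j) := by ring
    _ ≤ 16 * (5 + 4) ^ (K + M) := Nat.mul_le_mul_left _ hC
    _ = 16 * 9 ^ (K + M) := by norm_num
    _ ≤ 8 ^ K * 10 ^ M := hE
    _ = 2 ^ (K + M) * (5 ^ M * 4 ^ K) := by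
        rw [show (8 : ℕ) = 2 ^ 3 by norm_num, show (10 : ℕ) = 2 * 5 by norm_num,
          show (4 : ℕ) = 2 ^ 2 by norm_num, ← pow_mul, mul_pow, ← pow_mul, pow_add]
        ring

end Explicit

end ThmN

end PercRepro
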